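import Literature.AlgebraicGeometry.Motives.HodgeThetaSubalgebraSymplecticRankFour
import Literature.AlgebraicGeometry.Motives.HodgeThetaSubalgebraUnitary
import Literature.AlgebraicGeometry.Motives.HodgeThetaSubalgebraReductive
import HarnessLib

/-!
# The orbit lemma on the `K`-eigenspace of the Weil square: `W⁺ = W ∩ V^{1,0}` (and `W⁻`) has no proper non-zero subspace stable under the Hodge-degree-zero part of `Lie Hg ⊗ ℂ` (Gordon §6, proof of Thm. 6.3.3; brick S0 of the (3|3) WEIL square)

Family `hodge`, layer `Literature/AlgebraicGeometry/Motives` (abstract polarizable `ℚ`-Hodge structures; no geometry), namespace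
`Literature.AlgebraicGeometry.Motives.HodgeStructure`, grouping sub-namespace `WeilSquare`. THEOREMS ONLY (no definition, no named
fact, no `sorry`). Written for the cell `pub-hodgeav-hg6` (req-37 (A) Q2b; eng-4 g7, brick S0 of `HOME/jobs/WEIL33-eng4g7/DESIGN.md` REV 2:
the irreducibility input of S1 «`𝔊⁰|_{W⁺} = 𝔤𝔩(W⁺)`»). HONEST FRAMING: nothing here proves HC / HC_AV / HC_CM; unconditional linear
algebra of Hodge structures; no step towards a summit statement.

SETTING (`Motives/HodgeThetaSubalgebraUnitary`): `H` effective polarized of weight `1`, `φ ∈ End_Hdg(V)` with `φ² = −d` (`d > 0`),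
`End_Hdg(V) = ℚ + ℚφ`, `μ² = −d`, `W = ker(φ_ℂ − μ)`; `𝔥_ℂ = hodgeLieC H`. The tree's `UnitaryTheta.eq_bot_or_eq_of_stable` (G3) says
`W` has no proper non-zero `Lie Hg`-stable subspace. THIS FILE reads the tree's ORBIT LEMMA (`SymplecticThetaSix.eq_bot_or_eq_of_stable_le`:
«a subspace of the `+1`-eigenspace stable under the Levi part is `0` or everything», Gordon §6) on `W` WITHOUT passing to the subtype
`↥W`: for an involution `T ∈ 𝔥_ℂ` with eigenspaces `P ⊕ Q = V_ℂ` (e.g. `T = ±Θ`, `P, Q = V^{1,0}, V^{0,1}`), a subspace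
`U ⊆ W ∩ P` stable under every element of `𝔥_ℂ` preserving `P` and `Q` is `0` or `W ∩ P`:
**`WeilSquare.eq_bot_or_eq_inf_of_stable`**, with the two readings **`WeilSquare.eq_bot_or_eq_plus_of_stable`** (`W⁺ = W ∩ V^{1,0}`)
and **`WeilSquare.eq_bot_or_eq_minus_of_stable`** (`W⁻ = W ∩ V^{0,1}`). PROOF: the orbit `U' = U + Σ_{C lowering} C U ⊆ W` is
`Lie Hg`-stable (`SymplecticTheta.exists_decomp`: `Z = Z₋ + Z₀ + Z₊`; `Z₀`, `[Z₊, C]` preserve `P`, `Q`; `Z₋ u`, `[Z₀, C]u`, `C Z₀ u`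
are of the form `C′u′`), hence `0` or `W` by G3, and the `P`-components of `U'` lie in `U`.

## References

* [Gordon1997] B. B. Gordon, arXiv:alg-geom/9709030, §6 (proof of Thm. 6.3.3, p. 19: the orbit of a highest-weight line).
* [GoodmanWallachGTM255] R. Goodman, N. Wallach, GTM 255, §2.1.2, §4.1.1.
* [MoonenZarhin1999LowDim] B. Moonen, Yu. Zarhin, Math. Ann. 315 (1999), §2 (2.3).
-/

noncomputable section

open scoped TensorProduct

namespace Literature.AlgebraicGeometry.Motives

namespace HodgeStructure

universe u

variable {V : Type u} [AddCommGroup V] [Module ℚ V] [Module.Finite ℚ V] [HodgeTensorFacts.{u, u}] {n : ℤ}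

set_option maxHeartbeats 800000 in
/-- **The orbit lemma on `W = ker(φ_ℂ − μ)`.** `End_Hdg(V) = ℚ + ℚφ`, `φ² = −d`; `T ∈ 𝔥_ℂ` an involution with `V_ℂ = P ⊕ Q`
(`T = 1` on `P`, `−1` on `Q`). A subspace `U ⊆ W ∩ P` stable under every `Y ∈ 𝔥_ℂ` preserving `P` and `Q` is `0` or `W ∩ P`:
its orbit `U + Σ_{C ∈ 𝔥_ℂ lowering} C U ⊆ W` is `Lie Hg`-stable, hence `0` or `W` (`UnitaryTheta.eq_bot_or_eq_of_stable`), and has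
its `P`-components in `U`. [cite: Gordon1997, §6 (proof of Thm. 6.3.3, p. 19)] [cite: GoodmanWallachGTM255, §2.1.2] -/
theorem WeilSquare.eq_bot_or_eq_inf_of_stable (H : HodgeStructure V n) (hn : n = 1) (heff : H.IsEffective)
    (ψ : H.Polarization) {φ : Module.End ℚ V} (hφE : φ ∈ H.endAlg) {d : ℚ} (hd : 0 < d) (hφ2 : φ * φ = -(d • 1))
    (hE : ∀ a ∈ H.endAlg, ∃ x y : ℚ, a = x • 1 + y • φ) {μ : ℂ} (hμ : μ ^ 2 = -(d : ℂ))
    {T : Module.End ℂ (ℂ ⊗[ℚ] V)} (hT : T ∈ H.hodgeLieC) (hTT : ∀ v, T (T v) = v) {P Q : Submodule ℂ (ℂ ⊗[ℚ] V)}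
    (hP : ∀ x ∈ P, T x = x) (hQ : ∀ x ∈ Q, T x = -x) (hPmem : ∀ v, (2 : ℂ)⁻¹ • (v + T v) ∈ P)
    (hQmem : ∀ v, (2 : ℂ)⁻¹ • (v - T v) ∈ Q) (U : Submodule ℂ (ℂ ⊗[ℚ] V))
    (hUW : U ≤ Module.End.eigenspace (φ.baseChange ℂ) μ) (hUP : U ≤ P)
    (hst : ∀ Y ∈ H.hodgeLieC, (∀ p ∈ P, Y p ∈ P) → (∀ q ∈ Q, Y q ∈ Q) → ∀ u ∈ U, Y u ∈ U) :
    U = ⊥ ∨ U = Module.End.eigenspace (φ.baseChange ℂ) μ ⊓ P := by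
  classical
  obtain ⟨hbr, hskew, hcomm, Θ, hΘ, hΘ𝔤⟩ := hodgeLie_standing H ψ
  set W := Module.End.eigenspace (φ.baseChange ℂ) μ with hWdef
  have hbrC : ∀ Y ∈ H.hodgeLieC, ∀ Z ∈ H.hodgeLieC, Y * Z - Z * Y ∈ H.hodgeLieC := fun Y hY Z hZ =>
    H.commutator_mem_hodgeLieC hY hZ
  have hcφ : ∀ {Y}, Y ∈ H.hodgeLieC → Y * φ.baseChange ℂ = φ.baseChange ℂ * Y := fun {Y} hY =>
    H.commute_baseChange_of_mem_hodgeLieC hY ⟨φ, hφE⟩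
  have hYW : ∀ {Y}, Y ∈ H.hodgeLieC → ∀ w ∈ W, Y w ∈ W := fun {Y} hY w hw =>
    UnitaryTheta.apply_mem_eigenspace_of_commute (hcφ hY) hw
  have hdec := fun Z (hZ : Z ∈ H.hodgeLieC) => SymplecticTheta.exists_decomp H.hodgeLieC hbrC hT hTT hP hQ hPmem hQmem hZ
  have hPQ0 : ∀ x ∈ P, x ∈ Q → x = 0 := fun x hxP hxQ => by
    have h1 := hP x hxP
    rw [hQ x hxQ, neg_eq_iff_add_eq_zero, ← two_smul ℂ x, smul_eq_zero] at h1
    exact h1.resolve_left (two_ne_zero' ℂ)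
  -- an operator preserving `P` and `Q`: the commutator of a raising and a lowering one
  have hpres : ∀ {Zp C : Module.End ℂ (ℂ ⊗[ℚ] V)}, (∀ p ∈ P, Zp p = 0) → (∀ v, Zp v ∈ P) →
      (∀ q ∈ Q, C q = 0) → (∀ v, C v ∈ Q) →
      (∀ p ∈ P, (Zp * C - C * Zp) p ∈ P) ∧ (∀ q ∈ Q, (Zp * C - C * Zp) q ∈ Q) := by
    intro Zp C hZpP hZpim hCQ hCim
    refine ⟨fun p hp => ?_, fun q hq => ?_⟩
    · rw [LinearMap.sub_apply, Module.End.mul_apply, Module.End.mul_apply, hZpP p hp, map_zero, sub_zero]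
      exact hZpim _
    · rw [LinearMap.sub_apply, Module.End.mul_apply, Module.End.mul_apply, hCQ q hq, map_zero, zero_sub]
      exact Submodule.neg_mem _ (hCim _)
  -- the orbit `U' = U + span {C u : C lowering, u ∈ U}`
  set S : Set (ℂ ⊗[ℚ] V) := {x | ∃ C ∈ H.hodgeLieC, (∀ q ∈ Q, C q = 0) ∧ (∀ v, C v ∈ Q) ∧ ∃ u ∈ U, x = C u} with hS
  set U' : Submodule ℂ (ℂ ⊗[ℚ] V) := U ⊔ Submodule.span ℂ S with hU'
  have hUU' : U ≤ U' := le_sup_left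
  have hSU' : ∀ C ∈ H.hodgeLieC, (∀ q ∈ Q, C q = 0) → (∀ v, C v ∈ Q) → ∀ u ∈ U, C u ∈ U' :=
    fun C hC h1 h2 u hu => le_sup_right (b := Submodule.span ℂ S) (Submodule.subset_span ⟨C, hC, h1, h2, u, hu, rfl⟩)
  have hSQ : ∀ x ∈ Submodule.span ℂ S, x ∈ Q := by
    intro x hx
    induction hx using Submodule.span_induction with
    | mem x hx =>
      obtain ⟨C, -, -, hCim, u, -, rfl⟩ := hx
      exact hCim u
    | zero => exact Submodule.zero_mem _
    | add x y _ _ hx hy => exact Submodule.add_mem _ hx hy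
    | smul a x _ hx => exact Submodule.smul_mem _ a hx
  have hU'W : U' ≤ W := by
    rw [hU']
    refine sup_le hUW (Submodule.span_le.2 ?_)
    rintro _ ⟨C, hC, -, -, u, hu, rfl⟩
    exact hYW hC u (hUW hu)
  -- `U'` is stable under `Lie Hg`
  have hU'st : ∀ X ∈ H.hodgeLie, ∀ x ∈ U', X.baseChange ℂ x ∈ U' := by
    intro X hX x hx
    set Z := X.baseChange ℂ with hZdef
    have hZ : Z ∈ H.hodgeLieC := H.baseChange_mem_hodgeLieC hX
    obtain ⟨Zm, hZm, Z0, hZ0, Zp, hZp, hZeq, hZpP, hZpim, hZmQ, hZmim, -, -, hZ0P, hZ0Q⟩ := hdec Z hZ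
    -- on `U`
    have hZU : ∀ u ∈ U, Z u ∈ U' := by
      intro u hu
      rw [hZeq, LinearMap.add_apply, LinearMap.add_apply, hZpP u (hUP hu), add_zero]
      exact Submodule.add_mem _ (hSU' Zm hZm hZmQ hZmim u hu) (hUU' (hst Z0 hZ0 hZ0P hZ0Q u hu))
    -- on the generators `C u`
    have hZCu : ∀ C ∈ H.hodgeLieC, (∀ q ∈ Q, C q = 0) → (∀ v, C v ∈ Q) → ∀ u ∈ U, Z (C u) ∈ U' := by
      intro C hC hCQ hCim u hu
      have huP : u ∈ P := hUP hu
      -- `Z (C u) = Zm (C u) + Z0 (C u) + Zp (C u)`, `Zm (C u) = 0`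
      have h1 : Zm (C u) = 0 := hZmQ _ (hCim u)
      -- `Z0 (C u) = [Z0, C] u + C (Z0 u)`, `[Z0, C]` lowering
      have hZ0C : Z0 * C - C * Z0 ∈ H.hodgeLieC := hbrC Z0 hZ0 C hC
      have hZ0CQ : ∀ q ∈ Q, (Z0 * C - C * Z0) q = 0 := fun q hq => by
        rw [LinearMap.sub_apply, Module.End.mul_apply, Module.End.mul_apply, hCQ q hq, map_zero, hCQ _ (hZ0Q q hq), sub_zero]
      have hZ0Cim : ∀ v, (Z0 * C - C * Z0) v ∈ Q := fun v => by
        rw [LinearMap.sub_apply, Module.End.mul_apply, Module.End.mul_apply]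
        exact Submodule.sub_mem _ (hZ0Q _ (hCim v)) (hCim _)
      have h2 : Z0 (C u) = (Z0 * C - C * Z0) u + C (Z0 u) := by
        rw [LinearMap.sub_apply, Module.End.mul_apply, Module.End.mul_apply, sub_add_cancel]
      -- `Zp (C u) = [Zp, C] u` (`Zp u = 0`), `[Zp, C]` preserves `P`, `Q`
      have hZpC : Zp * C - C * Zp ∈ H.hodgeLieC := hbrC Zp hZp C hC
      obtain ⟨hZpCP, hZpCQ⟩ := hpres hZpP hZpim hCQ hCim
      have h3 : Zp (C u) = (Zp * C - C * Zp) u := by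
        rw [LinearMap.sub_apply, Module.End.mul_apply, Module.End.mul_apply, hZpP u huP, map_zero, sub_zero]
      rw [hZeq, LinearMap.add_apply, LinearMap.add_apply, h1, zero_add, h2, h3]
      refine Submodule.add_mem _ (Submodule.add_mem _ (hSU' _ hZ0C hZ0CQ hZ0Cim u hu)
        (hSU' C hC hCQ hCim _ (hst Z0 hZ0 hZ0P hZ0Q u hu))) (hUU' (hst _ hZpC hZpCP hZpCQ u hu))
    rw [hU'] at hx
    obtain ⟨y, hy, z, hz, rfl⟩ := Submodule.mem_sup.1 hx
    rw [map_add]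
    refine Submodule.add_mem _ (hZU y hy) ?_
    clear hx
    induction hz using Submodule.span_induction with
    | mem x hx =>
      obtain ⟨C, hC, hCQ, hCim, u, hu, rfl⟩ := hx
      exact hZCu C hC hCQ hCim u hu
    | zero => rw [map_zero]; exact Submodule.zero_mem _
    | add x x' _ _ hx hx' => rw [map_add]; exact Submodule.add_mem _ hx hx'
    | smul a x _ hx => rw [map_smul]; exact Submodule.smul_mem _ a hx
  -- G3: `U' = 0` or `U' = W`
  rcases UnitaryTheta.eq_bot_or_eq_of_stable H hn heff ψ hφE hd hφ2 hE hμ H.hodgeLie hΘ hΘ𝔤 hcomm hskew hU'W hU'st with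
    hbot | htop
  · left
    rw [eq_bot_iff, ← hbot]
    exact hUU'
  · right
    refine le_antisymm (le_inf hUW hUP) fun w hw => ?_
    obtain ⟨hwW, hwP⟩ := Submodule.mem_inf.1 hw
    have hwU' : w ∈ U' := htop.symm ▸ hwW
    rw [hU'] at hwU'
    obtain ⟨y, hy, z, hz, rfl⟩ := Submodule.mem_sup.1 hwU'
    -- `z = (y + z) − y ∈ P ∩ Q = 0`
    have hzP : z ∈ P := by
      have h := Submodule.sub_mem _ hwP (hUP hy)
      rwa [add_sub_cancel_left] at h
    rw [hPQ0 z hzP (hSQ z hz), add_zero]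
    exact hy

/-- **`W⁺ = W ∩ V^{1,0}` has no proper non-zero subspace stable under the Hodge-degree-zero part of `𝔥_ℂ`** (the elements of
`𝔥_ℂ` preserving `V^{1,0}` and `V^{0,1}`; `T = Θ`). [cite: Gordon1997, §6 (proof of Thm. 6.3.3, p. 19)] -/
theorem WeilSquare.eq_bot_or_eq_plus_of_stable (H : HodgeStructure V n) (hn : n = 1) (heff : H.IsEffective)
    (ψ : H.Polarization) {φ : Module.End ℚ V} (hφE : φ ∈ H.endAlg) {d : ℚ} (hd : 0 < d) (hφ2 : φ * φ = -(d • 1))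
    (hE : ∀ a ∈ H.endAlg, ∃ x y : ℚ, a = x • 1 + y • φ) {μ : ℂ} (hμ : μ ^ 2 = -(d : ℂ))
    (U : Submodule ℂ (ℂ ⊗[ℚ] V)) (hU : U ≤ Module.End.eigenspace (φ.baseChange ℂ) μ ⊓ H.piece 1 0)
    (hst : ∀ Y ∈ H.hodgeLieC, (∀ p ∈ H.piece 1 0, Y p ∈ H.piece 1 0) → (∀ q ∈ H.piece 0 1, Y q ∈ H.piece 0 1) →
      ∀ u ∈ U, Y u ∈ U) :
    U = ⊥ ∨ U = Module.End.eigenspace (φ.baseChange ℂ) μ ⊓ H.piece 1 0 := by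
  subst hn
  obtain ⟨Θ, hΘ⟩ := exists_hodgeTheta H
  obtain ⟨hPmem, hQmem, hΘ10, hΘ01, hΘΘ⟩ := UnitaryTheta.theta_facts H rfl heff hΘ
  exact WeilSquare.eq_bot_or_eq_inf_of_stable H rfl heff ψ hφE hd hφ2 hE hμ (H.mem_hodgeLieC_of_forall_piece hΘ) hΘΘ hΘ10 hΘ01
    hPmem hQmem U (hU.trans inf_le_left) (hU.trans inf_le_right) hst

/-- **`W⁻ = W ∩ V^{0,1}` has no proper non-zero subspace stable under the Hodge-degree-zero part of `𝔥_ℂ`** (`T = −Θ`).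
[cite: Gordon1997, §6 (proof of Thm. 6.3.3, p. 19)] -/
theorem WeilSquare.eq_bot_or_eq_minus_of_stable (H : HodgeStructure V n) (hn : n = 1) (heff : H.IsEffective)
    (ψ : H.Polarization) {φ : Module.End ℚ V} (hφE : φ ∈ H.endAlg) {d : ℚ} (hd : 0 < d) (hφ2 : φ * φ = -(d • 1))
    (hE : ∀ a ∈ H.endAlg, ∃ x y : ℚ, a = x • 1 + y • φ) {μ : ℂ} (hμ : μ ^ 2 = -(d : ℂ))
    (U : Submodule ℂ (ℂ ⊗[ℚ] V)) (hU : U ≤ Module.End.eigenspace (φ.baseChange ℂ) μ ⊓ H.piece 0 1)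
    (hst : ∀ Y ∈ H.hodgeLieC, (∀ p ∈ H.piece 1 0, Y p ∈ H.piece 1 0) → (∀ q ∈ H.piece 0 1, Y q ∈ H.piece 0 1) →
      ∀ u ∈ U, Y u ∈ U) :
    U = ⊥ ∨ U = Module.End.eigenspace (φ.baseChange ℂ) μ ⊓ H.piece 0 1 := by
  subst hn
  obtain ⟨Θ, hΘ⟩ := exists_hodgeTheta H
  obtain ⟨hPmem, hQmem, hΘ10, hΘ01, hΘΘ⟩ := UnitaryTheta.theta_facts H rfl heff hΘ
  have hnΘ : -Θ ∈ H.hodgeLieC := Submodule.neg_mem _ (H.mem_hodgeLieC_of_forall_piece hΘ)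
  have hnΘΘ : ∀ v, (-Θ) ((-Θ) v) = v := fun v => by rw [LinearMap.neg_apply, LinearMap.neg_apply, map_neg, neg_neg, hΘΘ]
  have hP' : ∀ x ∈ H.piece 0 1, (-Θ) x = x := fun x hx => by rw [LinearMap.neg_apply, hΘ01 x hx, neg_neg]
  have hQ' : ∀ x ∈ H.piece 1 0, (-Θ) x = -x := fun x hx => by rw [LinearMap.neg_apply, hΘ10 x hx]
  have hPmem' : ∀ v, (2 : ℂ)⁻¹ • (v + (-Θ) v) ∈ H.piece 0 1 := fun v => by
    rw [LinearMap.neg_apply, ← sub_eq_add_neg]; exact hQmem v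
  have hQmem' : ∀ v, (2 : ℂ)⁻¹ • (v - (-Θ) v) ∈ H.piece 1 0 := fun v => by
    rw [LinearMap.neg_apply, sub_neg_eq_add]; exact hPmem v
  exact WeilSquare.eq_bot_or_eq_inf_of_stable H rfl heff ψ hφE hd hφ2 hE hμ hnΘ hnΘΘ hP' hQ' hPmem' hQmem' U
    (hU.trans inf_le_left) (hU.trans inf_le_right) fun Y hY h1 h2 => hst Y hY h2 h1

end HodgeStructure

end Literature.AlgebraicGeometry.Motives

end
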